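import Mathlib
import HarnessLib
import Literature.Analysis.FluidPDE.ClassicalSolution
import Literature.Analysis.FluidPDE.LerayHopf
import Literature.Analysis.FluidPDE.SelfSimilar
import Literature.Analysis.FluidPDE.LocalTypeI
import Literature.Analysis.FluidPDE.VectorCalculus
import Literature.Analysis.FluidPDE.SereginSverak2002PressureLowerBound
import Literature.Analysis.FluidPDE.TypeIAncientMild
import Literature.Analysis.UnboundedOperators.HeatKernel
import Literature.Analysis.FluidPDE.TaoEnstrophyLocalisation
import Literature.Analysis.FluidPDE.NSLocalLerayBackwardUniqueness
import Literature.Analysis.FluidPDE.HyperbolicDSSOrbit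
import Literature.Analysis.FluidPDE.KinematicHubbleThreshold
import Summits.NavierStokesRegularity.NavierStokesRegularity.Theorems.LocalSineTubeDoorLocalPointZoomGradSlices
import Summits.NavierStokesRegularity.NavierStokesRegularity.Theorems.LocalSineTubeDoorProfileAlignedWindowRigidityAncient
import Summits.NavierStokesRegularity.NavierStokesRegularity.Theorems.DirectionEchoDoorDefs

/-!
# DirectionEchoDoorDoors — S24 «DirectionEchoDoor» (the Constantin–Fefferman quantity in two-time form), part 2/2

§1 the deciding implication `closesDirEcho` (logic) and sanity lemmas; §2 K1-dir PROVED: `dirEcho_windowLimit` (first-order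
velocity/gradient zoom + window Fatou, `curl` read off `fderiv`), `hasParallelVorticityEcho_of_window` (slice analyticity),
`localPointZoomDirEcho_holds`; `targetDirEchoAllRatios_of_residue` (door T2-dir from K2-dir).

Door family of LADDER-NS N0 (local Type-I window doors S20–S24); THEOREMS-ONLY landing of the nsreg-p1 design
`run/shared/lean/pub/ns-regularity-ideate/ns-regularity-ideate-p1/r23/Sketch24seedK1.lean` 6dc70f138da379af (ROUND-23.md
36a066550160a20a).  Door T2-dir «direction echo at all ratios»: K1-dir `LocalPointZoomDirEcho` PROVED (part 2/2), the door
`closesDirEcho` PROVED (logic), CONDITIONAL on exactly one OPEN typed statement K2-dir `SIDirectionLiouville` (a Liouville theorem for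
Type-I ancient profiles with SCALE-INVARIANT VORTICITY DIRECTION; hypothesis class ⊋ self-similar ∪ constant-direction ∪
axisymmetric-no-swirl; not in print).  No route, no items (DIRECTOR-NS standing #32 (2)).  WHAT THIS IS NOT: not a regularity
claim; K2-dir is NOT asserted, it is the seat-purpose deliverable «the exact first statement not in print».
-/

noncomputable section

set_option linter.dupNamespace false
set_option linter.unusedVariables false

namespace Summit.NavierStokesRegularity.NavierStokesRegularity.Theorems.DirectionEchoDoorDoors

open MeasureTheory Set Function Filter Topology TopologicalSpace Metric
open scoped RealInnerProductSpace NNReal ENNReal Topology Pointwise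
open Literature.Analysis Literature.Analysis.FluidPDE
open Summit.NavierStokesRegularity.NavierStokesRegularity.Theorems.LocalSineTubeDoorProfileAlignedWindowRigidityAncient
open Summit.NavierStokesRegularity.NavierStokesRegularity.Theorems.DirectionEchoDoorDefs

/-! ## §2 The deciding implication and sanity lemmas -/

variable {v : ℝ → EuclideanSpace ℝ (Fin 3) → EuclideanSpace ℝ (Fin 3)}

/-- **`closesDirEcho`**: the universal direction-echo zoom and the scale-invariant-direction Liouville statement decide the door. -/
theorem closesDirEcho (h₁ : LocalPointZoomDirEcho) (h₂ : SIDirectionLiouville) : TargetDirEchoAllRatios := by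
  intro ν T hν hT u p hcl hLH hdec x₀ ρ M hρ hM hfade
  by_contra hbb
  obtain ⟨C, v, hrate, hcont, hmild, hdiv, hsing, hecho⟩ := h₁ ν T hν hT u p hcl hLH hdec x₀ ρ M hρ hM hbb
  refine h₂ C v hrate hcont hmild hdiv ?_ hsing
  intro κ hκ hκ1
  obtain ⟨U, hU, hUne, hf⟩ := hfade κ hκ hκ1
  exact hecho κ hκ hκ1 U hU hUne hf

/-- The assembly holds (by `closesDirEcho`). -/
theorem dirEchoAssembly_holds : DirEchoAssembly := fun h₁ h₂ => closesDirEcho h₁ h₂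

/-- Sanity (the irrotational stratum is inside the hypothesis, harmlessly): a profile with identically vanishing
vorticity has the parallel echo at every ratio. -/
theorem hasParallelVorticityEcho_of_curl_eq_zero (hω : ∀ s < 0, ∀ z, curl (v s) z = 0) {κ : ℝ} (hκ : 0 < κ) :
    HasParallelVorticityEcho κ v := by
  intro s hs z
  rw [hω s hs z, cross_zero_left]

/-- Sanity: the parallel echo is symmetric under `κ ↦ κ⁻¹` up to the substitution `(s, z) ↦ (κ⁻¹ s, (√κ)⁻¹ z)` — recorded
as the pointwise statement it reduces to (antisymmetry of the cross product). -/
theorem cross_eq_zero_comm (a b : EuclideanSpace ℝ (Fin 3)) : cross a b = 0 ↔ cross b a = 0 := by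
  constructor <;> intro h
  · have : cross b a = -cross a b := by
      simp only [cross, ← WithLp.toLp_neg, neg_cross]
    rw [this, h, neg_zero]
  · have : cross a b = -cross b a := by
      simp only [cross, ← WithLp.toLp_neg, neg_cross]
    rw [this, h, neg_zero]


/-! ## §3 K1-dir PROVED: the universal direction-echo zoom

Port of ROUND-22 `twoTime_windowLimit` / `hasTwoPointSymmetry_of_window` to the gradient level: the tree's first-order
zoom `localPointZoomVelGradSlices` makes the rescaled GRADIENTS converge on every slice; `curl = curlCLM ∘ fderiv` and
the continuity of the bilinear `crossCLM` carry this to the two-time direction defect (`cross_smul_left/right`,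
`cross_zero_left` are the tree's Literature lemmas in `HyperbolicDSSOrbit` / `KinematicHubbleThreshold`); Fatou on the window; the cross
product of two real-analytic vorticity slices is real-analytic, so the window identity spreads to the slab. -/

/-- The cross product is jointly continuous. -/
theorem continuous_cross₂ : Continuous fun q : EuclideanSpace ℝ (Fin 3) × EuclideanSpace ℝ (Fin 3) => cross q.1 q.2 := by
  have h := (crossCLM).continuous₂
  exact h.congr fun q => crossCLM_apply q.1 q.2

section Core

variable {ν T : ℝ} {u : ℝ → EuclideanSpace ℝ (Fin 3) → EuclideanSpace ℝ (Fin 3)} {p : ℝ → EuclideanSpace ℝ (Fin 3) → ℝ}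
  {x₀ : EuclideanSpace ℝ (Fin 3)} {lam : ℕ → ℝ}

/-- **DIRECTION-ECHO WINDOW LIMIT.**  Along a first-order zoom `(λⱼ, v)` at `(x₀, T)` (rescaled GRADIENTS converge
pointwise on every slice; vorticity slices of `v` continuous), a faded direction echo at ratio `κ` on the open window `U`
forces, for every `s < 0` and `y ∈ U`, with `σ = √(−s)/√ν`:  `ω_v(s, σy) × ω_v(κ s, (√κ σ) y) = 0`. -/
theorem dirEcho_windowLimit (hν : 0 < ν) (hT : 0 < T) (hcl : IsClassicalNSSolutionOn (Ico 0 T) ν 0 u p)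
    (hlam : ∀ j, 0 < lam j) (hlam0 : Tendsto lam atTop (𝓝 0))
    (hslice : ∀ s < 0, Continuous (curl (v s)))
    (hconvD : ∀ s < 0, ∀ y,
      Tendsto (fun j => (lam j ^ 2 / ν) • fderiv ℝ (u (T + lam j ^ 2 * s / ν)) (x₀ + lam j • y)) atTop
        (𝓝 (fderiv ℝ (v s) y)))
    {κ : ℝ} (hκ : 0 < κ) {U : Set (EuclideanSpace ℝ (Fin 3))} (hU : IsOpen U)
    (hfade : DirEchoFades T x₀ u κ U) {s : ℝ} (hs : s < 0) {y : EuclideanSpace ℝ (Fin 3)} (hy : y ∈ U) :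
    cross (curl (v s) ((Real.sqrt (-s) / Real.sqrt ν) • y))
      (curl (v (κ * s)) ((Real.sqrt κ * (Real.sqrt (-s) / Real.sqrt ν)) • y)) = 0 := by
  -- ## zoom times `tⱼ = T + λⱼ² s/ν → T⁻` and their partners `t'ⱼ = T − κ(T − tⱼ) = T + λⱼ² (κs)/ν`
  have hns : 0 < -s := neg_pos.2 hs
  have hκs : κ * s < 0 := mul_neg_of_pos_of_neg hκ hs
  obtain ⟨t, ht⟩ : ∃ t : ℕ → ℝ, ∀ j, t j = T + lam j ^ 2 * s / ν := ⟨_, fun j => rfl⟩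
  have hTt : ∀ j, T - t j = lam j ^ 2 * (-s) / ν := fun j => by rw [ht j]; ring
  have ht' : ∀ j, T - κ * (T - t j) = T + lam j ^ 2 * (κ * s) / ν := fun j => by rw [ht j]; ring
  have hc : ∀ j, 0 < lam j ^ 2 * (-s) / ν := fun j => div_pos (mul_pos (pow_pos (hlam j) 2) hns) hν
  have hc0 : Tendsto (fun j => lam j ^ 2 * (-s) / ν) atTop (𝓝 0) := by
    simpa using ((hlam0.pow 2).mul_const (-s)).div_const ν
  have htT : Tendsto t atTop (𝓝[<] T) := by
    refine tendsto_nhdsWithin_iff.2 ⟨?_, Eventually.of_forall fun j => ?_⟩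
    · have h1 : Tendsto (fun j => T - lam j ^ 2 * (-s) / ν) atTop (𝓝 (T - 0)) :=
        tendsto_const_nhds.sub hc0
      rw [sub_zero] at h1
      refine h1.congr fun j => ?_
      rw [ht j]; ring
    · show t j < T
      have h1 := hc j
      rw [← hTt j] at h1
      linarith
  have hev : ∀ᶠ j in atTop, t j ∈ Set.Ioo 0 T ∧ T - κ * (T - t j) ∈ Set.Ioo 0 T := by
    have htT' : Tendsto (fun j => T - κ * (T - t j)) atTop (𝓝[<] T) := by
      refine tendsto_nhdsWithin_iff.2 ⟨?_, Eventually.of_forall fun j => ?_⟩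
      · have h1 : Tendsto (fun j => T - κ * (lam j ^ 2 * (-s) / ν)) atTop (𝓝 (T - κ * 0)) :=
          tendsto_const_nhds.sub (hc0.const_mul κ)
        rw [mul_zero, sub_zero] at h1
        refine h1.congr fun j => ?_
        rw [hTt j]
      · show T - κ * (T - t j) < T
        have h1 := mul_pos hκ (hc j)
        rw [← hTt j] at h1
        linarith
    exact (htT.eventually (Ioo_mem_nhdsLT hT)).and (htT'.eventually (Ioo_mem_nhdsLT hT))
  obtain ⟨j₀, hj₀⟩ := eventually_atTop.1 hev
  have hshift : Tendsto (fun j : ℕ => j + j₀) atTop atTop := tendsto_add_atTop_nat j₀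
  have hfadej : Tendsto (fun j => ∫⁻ y in U, ENNReal.ofReal (dirEchoDefect T x₀ u κ (t (j + j₀)) y))
      atTop (𝓝 0) := (hfade.comp htT).comp hshift
  -- ## the similarity scale along the zoom: `√(T − tⱼ) = λⱼ σ`, `T − tⱼ = λⱼ² σ²`, `σ = √(−s)/√ν`
  set σ : ℝ := Real.sqrt (-s) / Real.sqrt ν with hσ
  have hσpos : 0 < σ := div_pos (Real.sqrt_pos.2 hns) (Real.sqrt_pos.2 hν)
  have hσ2 : σ ^ 2 = -s / ν := by
    rw [hσ, div_pow, Real.sq_sqrt hns.le, Real.sq_sqrt hν.le]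
  have hsq : ∀ j, Real.sqrt (T - t j) = lam j * σ := by
    intro j
    rw [hTt j, hσ, Real.sqrt_div' _ hν.le, Real.sqrt_mul (pow_nonneg (hlam j).le 2),
      Real.sqrt_sq (hlam j).le]
    ring
  have hsqκ : ∀ j, Real.sqrt (κ * (T - t j)) = lam j * (Real.sqrt κ * σ) := by
    intro j
    rw [Real.sqrt_mul hκ.le, hsq j]
    ring
  have hTt2 : ∀ j, T - t j = σ ^ 2 * ν * (lam j ^ 2 / ν) := by
    intro j
    rw [hTt j, hσ2]
    field_simp
  -- the two window vorticities at time `tⱼ` versus the rescaled gradients at `σ y` and `(√κ σ) y`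
  set W : ℕ → EuclideanSpace ℝ (Fin 3) → EuclideanSpace ℝ (Fin 3) := fun j y =>
    (T - t (j + j₀)) • curl (u (t (j + j₀))) (x₀ + Real.sqrt (T - t (j + j₀)) • y) with hWdef
  have hW : ∀ (j : ℕ) (y : EuclideanSpace ℝ (Fin 3)), W j y =
      (σ ^ 2 * ν) • curlCLM ((lam (j + j₀) ^ 2 / ν) • fderiv ℝ (u (T + lam (j + j₀) ^ 2 * s / ν))
        (x₀ + lam (j + j₀) • (σ • y))) := by
    intro j y
    rw [hWdef]
    simp only
    rw [map_smul, smul_smul, ← hTt2 (j + j₀), curl_eq_curlCLM, hsq (j + j₀), ← smul_smul, ← ht (j + j₀)]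
  set W' : ℕ → EuclideanSpace ℝ (Fin 3) → EuclideanSpace ℝ (Fin 3) := fun j y =>
    (κ * (T - t (j + j₀))) • curl (u (T - κ * (T - t (j + j₀))))
      (x₀ + Real.sqrt (κ * (T - t (j + j₀))) • y) with hW'def
  have hW' : ∀ (j : ℕ) (y : EuclideanSpace ℝ (Fin 3)), W' j y =
      (κ * (σ ^ 2 * ν)) • curlCLM ((lam (j + j₀) ^ 2 / ν) • fderiv ℝ (u (T + lam (j + j₀) ^ 2 * (κ * s) / ν))
        (x₀ + lam (j + j₀) • ((Real.sqrt κ * σ) • y))) := by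
    intro j y
    rw [hW'def]
    simp only
    rw [map_smul, smul_smul, mul_assoc, ← hTt2 (j + j₀), curl_eq_curlCLM, hsqκ (j + j₀), ← ht' (j + j₀)]
    simp only [smul_smul]
  -- ## the limit defect in window coordinates and its continuity
  set a : EuclideanSpace ℝ (Fin 3) → EuclideanSpace ℝ (Fin 3) := fun y => (σ ^ 2 * ν) • curl (v s) (σ • y) with hadef
  set b : EuclideanSpace ℝ (Fin 3) → EuclideanSpace ℝ (Fin 3) := fun y =>
    (κ * (σ ^ 2 * ν)) • curl (v (κ * s)) ((Real.sqrt κ * σ) • y) with hbdef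
  set Hs : EuclideanSpace ℝ (Fin 3) → ℝ := fun y => ‖cross (a y) (b y)‖ with hHsdef
  have hac : Continuous a := by
    show Continuous fun y => (σ ^ 2 * ν) • curl (v s) (σ • y)
    exact ((hslice s hs).comp (continuous_const_smul σ)).const_smul (σ ^ 2 * ν)
  have hbc : Continuous b := by
    show Continuous fun y => (κ * (σ ^ 2 * ν)) • curl (v (κ * s)) ((Real.sqrt κ * σ) • y)
    exact ((hslice (κ * s) hκs).comp (continuous_const_smul (Real.sqrt κ * σ))).const_smul (κ * (σ ^ 2 * ν))
  have hHscont : Continuous Hs := (continuous_cross₂.comp (hac.prodMk hbc)).norm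
  have hconvW : ∀ y, Tendsto (fun j => W j y) atTop (𝓝 (a y)) := by
    intro y
    have h := (((hconvD s hs (σ • y)).comp hshift).const_smul (σ ^ 2 * ν))
    have h2 : Tendsto (fun j => (σ ^ 2 * ν) • curlCLM ((lam (j + j₀) ^ 2 / ν) •
        fderiv ℝ (u (T + lam (j + j₀) ^ 2 * s / ν)) (x₀ + lam (j + j₀) • (σ • y)))) atTop
        (𝓝 ((σ ^ 2 * ν) • curlCLM (fderiv ℝ (v s) (σ • y)))) :=
      ((curlCLM.continuous.tendsto _).comp ((hconvD s hs (σ • y)).comp hshift)).const_smul (σ ^ 2 * ν)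
    rw [hadef]
    simp only [curl_eq_curlCLM]
    exact h2.congr fun j => (hW j y).symm
  have hconvW' : ∀ y, Tendsto (fun j => W' j y) atTop (𝓝 (b y)) := by
    intro y
    have h2 : Tendsto (fun j => (κ * (σ ^ 2 * ν)) • curlCLM ((lam (j + j₀) ^ 2 / ν) •
        fderiv ℝ (u (T + lam (j + j₀) ^ 2 * (κ * s) / ν)) (x₀ + lam (j + j₀) • ((Real.sqrt κ * σ) • y)))) atTop
        (𝓝 ((κ * (σ ^ 2 * ν)) • curlCLM (fderiv ℝ (v (κ * s)) ((Real.sqrt κ * σ) • y)))) :=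
      ((curlCLM.continuous.tendsto _).comp ((hconvD (κ * s) hκs ((Real.sqrt κ * σ) • y)).comp hshift)).const_smul _
    rw [hbdef]
    simp only [curl_eq_curlCLM]
    exact h2.congr fun j => (hW' j y).symm
  have hconvH : ∀ y, Tendsto (fun j => ‖cross (W j y) (W' j y)‖) atTop (𝓝 (Hs y)) := fun y =>
    ((continuous_cross₂.tendsto _).comp ((hconvW y).prodMk_nhds (hconvW' y))).norm
  -- measurability of the window fields: `u(tⱼ)`, `u(t'ⱼ)` are smooth for the shifted times
  have hmem : ∀ j, t (j + j₀) ∈ Set.Ico 0 T := fun j =>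
    ⟨((hj₀ (j + j₀) (Nat.le_add_left _ _)).1).1.le, ((hj₀ (j + j₀) (Nat.le_add_left _ _)).1).2⟩
  have hmem' : ∀ j, T - κ * (T - t (j + j₀)) ∈ Set.Ico 0 T := fun j =>
    ⟨((hj₀ (j + j₀) (Nat.le_add_left _ _)).2).1.le, ((hj₀ (j + j₀) (Nat.le_add_left _ _)).2).2⟩
  have hφ : ∀ c : ℝ, Continuous fun y : EuclideanSpace ℝ (Fin 3) => x₀ + c • y :=
    fun c => continuous_const.add (continuous_const_smul _)
  have hcurlc : ∀ t₁ ∈ Set.Ico 0 T, Continuous (curl (u t₁)) := by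
    intro t₁ ht₁
    rw [curl_eq_curlCLM_comp]
    have h1 : ContDiff ℝ 1 (u t₁) := (hcl.contDiff_velocity ht₁).of_le (by norm_cast)
    exact curlCLM.continuous.comp (h1.continuous_fderiv one_ne_zero)
  have hWc : ∀ j, Continuous (W j) := fun j => by
    show Continuous fun y => (T - t (j + j₀)) • curl (u (t (j + j₀))) (x₀ + Real.sqrt (T - t (j + j₀)) • y)
    exact ((hcurlc _ (hmem j)).comp (hφ (Real.sqrt (T - t (j + j₀))))).const_smul (T - t (j + j₀))
  have hW'c : ∀ j, Continuous (W' j) := fun j => by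
    show Continuous fun y => (κ * (T - t (j + j₀))) • curl (u (T - κ * (T - t (j + j₀))))
      (x₀ + Real.sqrt (κ * (T - t (j + j₀))) • y)
    exact ((hcurlc _ (hmem' j)).comp (hφ (Real.sqrt (κ * (T - t (j + j₀)))))).const_smul (κ * (T - t (j + j₀)))
  have hFjc : ∀ j, Continuous fun y => ‖cross (W j y) (W' j y)‖ := fun j =>
    (continuous_cross₂.comp ((hWc j).prodMk (hW'c j))).norm
  have hdefect : ∀ j y, dirEchoDefect T x₀ u κ (t (j + j₀)) y = ‖cross (W j y) (W' j y)‖ := fun j y => rfl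
  -- ## FATOU: the faded defect vanishes on the window in the limit
  set g : EuclideanSpace ℝ (Fin 3) → ℝ≥0∞ := fun y => ENNReal.ofReal (Hs y) with hg
  have hgc : Continuous g := ENNReal.continuous_ofReal.comp hHscont
  have hgjm : ∀ j, Measurable fun y => ENNReal.ofReal ‖cross (W j y) (W' j y)‖ :=
    fun j => (ENNReal.continuous_ofReal.comp (hFjc j)).measurable
  have hptw : ∀ y, Tendsto (fun j => ENNReal.ofReal ‖cross (W j y) (W' j y)‖) atTop (𝓝 (g y)) :=
    fun y => ENNReal.tendsto_ofReal (hconvH y)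
  have hFatou : ∫⁻ y in U, liminf (fun j => ENNReal.ofReal ‖cross (W j y) (W' j y)‖) atTop ≤
      liminf (fun j => ∫⁻ y in U, ENNReal.ofReal ‖cross (W j y) (W' j y)‖) atTop :=
    lintegral_liminf_le' (fun j => (hgjm j).aemeasurable)
  have hlim : (fun y => liminf (fun j => ENNReal.ofReal ‖cross (W j y) (W' j y)‖) atTop) = g :=
    funext fun y => (hptw y).liminf_eq
  have hfadeW : Tendsto (fun j => ∫⁻ y in U, ENNReal.ofReal ‖cross (W j y) (W' j y)‖) atTop (𝓝 0) := by
    refine hfadej.congr fun j => ?_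
    simp only [hdefect]
  rw [hlim, hfadeW.liminf_eq] at hFatou
  have hint : ∫⁻ y in U, g y = 0 := le_antisymm hFatou bot_le
  have hae : ∀ᵐ y ∂(volume.restrict U), g y = 0 := (lintegral_eq_zero_iff hgc.measurable).1 hint
  rw [ae_restrict_iff' hU.measurableSet] at hae
  have hzero : ∀ y ∈ U, g y = 0 := by
    intro y hy
    by_contra hne
    set O : Set (EuclideanSpace ℝ (Fin 3)) := U ∩ g ⁻¹' (Ioi 0) with hO
    have hOo : IsOpen O := hU.inter (isOpen_Ioi.preimage hgc)
    have hO0 : volume O = 0 := by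
      rw [measure_eq_zero_iff_ae_notMem]
      filter_upwards [hae] with y' hy'
      rintro ⟨h1, h2⟩
      have := hy' h1
      simp only [mem_preimage, mem_Ioi, this, lt_self_iff_false] at h2
    have hOe : O = ∅ := (hOo.measure_eq_zero_iff volume).1 hO0
    have hyO : y ∈ O := ⟨hy, by simpa [mem_preimage, mem_Ioi, pos_iff_ne_zero] using hne⟩
    rw [hOe] at hyO
    exact hyO
  have h := hzero y hy
  simp only [hg, ENNReal.ofReal_eq_zero] at h
  have h0 : Hs y = 0 := le_antisymm h (norm_nonneg _)
  have h1 : cross (a y) (b y) = 0 := norm_eq_zero.1 h0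
  rw [hadef, hbdef] at h1
  simp only at h1
  rw [cross_smul_left, cross_smul_right, smul_eq_zero, smul_eq_zero] at h1
  have hσν : σ ^ 2 * ν ≠ 0 := mul_ne_zero (pow_ne_zero 2 hσpos.ne') hν.ne'
  rcases h1 with h1 | h1 | h1
  · exact absurd h1 hσν
  · exact absurd h1 (mul_ne_zero hκ.ne' hσν)
  · exact h1

variable {v : ℝ → EuclideanSpace ℝ (Fin 3) → EuclideanSpace ℝ (Fin 3)}

/-- **SPREADING by slice analyticity.**  In the door class, the window identity of `dirEcho_windowLimit` on an open
nonempty `U` for every `s < 0` upgrades to the parallel vorticity echo on the whole slab (the cross product of two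
real-analytic vorticity slices is real-analytic; identity theorem on the connected `ℝ³`). -/
theorem hasParallelVorticityEcho_of_window {C : ℝ} (hrate : HasTypeITimeDecay C v)
    (hcont : ContinuousOn (uncurry v) (Iio (0 : ℝ) ×ˢ univ))
    (hmild : ∀ s t : ℝ, s < t → t < 0 → ∀ x,
      v t x = UnboundedOperators.heatExtension (v s) (t - s) x - oseenDuhamel 1 s v v t x)
    (hν : 0 < ν) {κ : ℝ} (hκ : 0 < κ) {U : Set (EuclideanSpace ℝ (Fin 3))} (hU : IsOpen U)
    (hUne : U.Nonempty)
    (hwin : ∀ s < 0, ∀ y ∈ U, cross (curl (v s) ((Real.sqrt (-s) / Real.sqrt ν) • y))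
      (curl (v (κ * s)) ((Real.sqrt κ * (Real.sqrt (-s) / Real.sqrt ν)) • y)) = 0) :
    HasParallelVorticityEcho κ v := by
  intro s hs z
  have hns : 0 < -s := neg_pos.2 hs
  have hκs : κ * s < 0 := mul_neg_of_pos_of_neg hκ hs
  set σ : ℝ := Real.sqrt (-s) / Real.sqrt ν with hσ
  have hσpos : 0 < σ := div_pos (Real.sqrt_pos.2 hns) (Real.sqrt_pos.2 hν)
  -- the identity on the open window `σ • U`
  have hwin' : ∀ w ∈ σ • U, cross (curl (v s) w) (curl (v (κ * s)) (Real.sqrt κ • w)) = 0 := by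
    rintro w ⟨y, hy, rfl⟩
    have h := hwin s hs y hy
    rwa [← smul_smul] at h
  -- both vorticity slices are real-analytic, hence so is the cross product
  have hbdd := bdd_of_hasTypeITimeDecay hrate
  have han1 : AnalyticOnNhd ℝ (curl (v s)) univ := analyticOnNhd_curl (analyticOnNhd_slice hcont hbdd hmild hs)
  have han2 : AnalyticOnNhd ℝ (curl (v (κ * s))) univ :=
    analyticOnNhd_curl (analyticOnNhd_slice hcont hbdd hmild hκs)
  have hanL : AnalyticOnNhd ℝ (fun w : EuclideanSpace ℝ (Fin 3) => Real.sqrt κ • w) univ := fun w _ =>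
    (analyticAt_id.const_smul (c := Real.sqrt κ))
  have han3 : AnalyticOnNhd ℝ (fun w => curl (v (κ * s)) (Real.sqrt κ • w)) univ :=
    han2.comp hanL (fun _ _ => mem_univ _)
  set f : EuclideanSpace ℝ (Fin 3) → EuclideanSpace ℝ (Fin 3) := fun w =>
    cross (curl (v s) w) (curl (v (κ * s)) (Real.sqrt κ • w)) with hf
  have hfan : AnalyticOnNhd ℝ f univ := by
    intro w hw
    have hb : AnalyticAt ℝ (fun q : EuclideanSpace ℝ (Fin 3) × EuclideanSpace ℝ (Fin 3) => crossCLM q.1 q.2)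
        (curl (v s) w, curl (v (κ * s)) (Real.sqrt κ • w)) := crossCLM.analyticAt_bilinear _
    have h := hb.comp₂ (han1 w hw) (han3 w hw)
    refine h.congr (Eventually.of_forall fun w' => ?_)
    simp only [hf, crossCLM_apply]
  -- `f` vanishes on the open nonempty set `σ • U`, hence everywhere
  obtain ⟨y₀, hy₀⟩ := hUne
  have hOpen : IsOpen (σ • U) := hU.smul₀ hσpos.ne'
  have hmem0 : σ • y₀ ∈ σ • U := smul_mem_smul_set hy₀
  have hfz : f =ᶠ[𝓝 (σ • y₀)] 0 := by
    filter_upwards [hOpen.mem_nhds hmem0] with w hw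
    simp only [hf, Pi.zero_apply]
    exact hwin' w hw
  have hEq : EqOn f 0 univ :=
    hfan.eqOn_zero_of_preconnected_of_eventuallyEq_zero isPreconnected_univ (mem_univ _) hfz
  have := hEq (mem_univ z)
  simpa only [hf, Pi.zero_apply] using this

end Core

/-- **K1-dir holds** (`LocalPointZoomDirEcho`): from the tree's first-order zoom `localPointZoomVelGradSlices`. -/
theorem localPointZoomDirEcho_holds : LocalPointZoomDirEcho := by
  intro ν T hν hT u p hcl hLH hdec x₀ ρ M hρ hM hnot
  obtain ⟨C, v, lam, hlam, hlam0, ⟨hrate, hcont, hmild, hdiv⟩, hsing, hconv⟩ :=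
    Summit.NavierStokesRegularity.NavierStokesRegularity.Theorems.LocalSineTubeDoorLocalPointZoomGradSlices.localPointZoomVelGradSlices
      ν T hν hT u p hcl hLH hdec x₀ ρ M hρ hM hnot
  refine ⟨C, v, hrate, hcont, hmild, hdiv, hsing, fun κ hκ hκ1 U hU hUne hfade => ?_⟩
  have hslice : ∀ s < 0, Continuous (curl (v s)) := fun s hs => by
    rw [← continuousOn_univ]
    exact (analyticOnNhd_curl (analyticOnNhd_slice hcont (bdd_of_hasTypeITimeDecay hrate) hmild hs)).continuousOn
  exact hasParallelVorticityEcho_of_window hrate hcont hmild hν hκ hU hUne fun s hs y hy =>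
    dirEcho_windowLimit hν hT hcl hlam hlam0 hslice (fun s hs y => (hconv s hs y).2) hκ hU hfade hs hy


/-- **The door is conditional on K2-dir alone**: `SIDirectionLiouville → TargetDirEchoAllRatios` (K1-dir discharged). -/
theorem targetDirEchoAllRatios_of_residue (h₂ : SIDirectionLiouville) : TargetDirEchoAllRatios :=
  closesDirEcho localPointZoomDirEcho_holds h₂

end Summit.NavierStokesRegularity.NavierStokesRegularity.Theorems.DirectionEchoDoorDoors
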